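import Mathlib.RingTheory.Smooth.Basic
import Mathlib.RingTheory.Smooth.Field
import Mathlib.Algebra.MvPolynomial.Expand
import Mathlib.RingTheory.Localization.AtPrime.Basic
import Mathlib.RingTheory.Localization.Ideal
import Mathlib.RingTheory.LocalRing.ResidueField.Basic
import Literature.AlgebraicGeometry.Resolution.HironakaGroupSchemeMultiplicity
import Literature.AlgebraicGeometry.Resolution.RidgeAlgebraDirects
import Literature.AlgebraicGeometry.Resolution.PointBlowupRidge
import HarnessLib

/-!
# [OURS · L1 W4.2] Frobenius-twisted polynomials vanishing at a prime with formally smooth residue field lie in the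
# symbolic power: `G(X^q) ∈ 𝔭 ⇒ G(X^q) ∈ 𝔭^{(q)}`; hence Giraud's ridge algebra of a cone sits inside Hironaka's `U(𝔭)`
# at every such point of the ridge (campaign s42, cell res-hironaka; toward [H4] Th. IV at separable / perfect points;
# `--supports` stmt-ResolutionOfSingularities-17845)

HONEST FRAMING. OURS (slot W4.2, prover res-L1-s42-pv-1, gen 7). The algebraic core of a PARTIAL discharge of the printed
fact F-51′ `Hironaka1970_thmIV` ([H4] = Hironaka 1970 (Kyoto) THEOREM IV: at a near point `x'` of a permissible blow-up the
ideal `J_D` of the fibre cone is generated by its elements in Hironaka's algebra `U(𝔭_{x'})` of forms of maximal multiplicity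
at `x'`). Dietel 2015 (Regensburg thesis, §9.2, (9.2.6)–(9.2.7)) isolates the difficulty of Theorem IV at INSEPARABLE points
and proves the separable descent with `p`-bases and differential operators; we replace that descent by a lifting argument:

* **`expand_mem_symbPow_of_formallySmooth`** — `K` a field of exponential characteristic `p`, `S = K[X_σ]`, `𝔭 ⊂ S` prime
  whose residue field `κ(𝔭)` is FORMALLY SMOOTH over `K` (e.g. every `𝔭` when `K` is perfect —
  `formallySmooth_residueField_of_perfectField`, Mathlib's `Algebra.FormallySmooth.of_perfectField`), `q = p^e`: every
  `θ = G(X_1^q, …, X_n^q)` (`MvPolynomial.expand q G`) with `θ ∈ 𝔭` lies in the symbolic power `𝔭^{(q)} = 𝔭^q S_𝔭 ∩ S`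
  (tree `HironakaScheme.symbPow`). PROOF: in `Q = S_𝔭/𝔭^q S_𝔭` the surjection `Q ↠ κ(𝔭)` has nilpotent kernel, so formal
  smoothness gives a `K`-algebra section `s`; `X_i ≡ s(X̄_i)` modulo the kernel, whose `q`-th powers vanish, so by Frobenius
  `X_i^q = s(X̄_i)^q` in `Q` and `θ = G(X^q) = s(G(X̄^q)) = s(θ(X̄)) = s(0) = 0`.
* **`sum_C_mul_X_pow_mem_multGens`** — an additive form `Σ c_k X_k^{p^e}` lying in such a `𝔭` is a homogeneous generator of
  `U(𝔭)` (tree `HironakaScheme.multGens`); **`ridgeAlgebra_le_multAlgebra`** — if the additive forms `ridgeForm p I` of the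
  ridge ideal `𝔉(I)` lie in `𝔭`, Giraud's algebra `U_F = K[ridgeForm]` lies in `U(𝔭)`; **`le_span_inter_multAlgebra_of_forall_ridgeForm_mem`**
  — then, for `I` homogeneous, `I ≤ span(I ∩ U(𝔭))` (THE CONCLUSION OF THEOREM IV for the cone `V(I)` at the point `𝔭`), by
  Giraud's (3) `I = (I ∩ U_F) S` (tree `eq_span_inter_ridgeAlgebra`).

Scheme-level consequences (Theorem IV at near points with perfect `κ(x)` / formally smooth cone-point residue field) are in the
companion file `…CampaignW42ThmIVOfFormallySmooth`. NOT a statement of H. Hironaka's manuscript [Hironaka2017]; not the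
printed Theorem IV (which has no residue-field hypothesis). AI-written; AI review is weaker than expert review.

References (orientation): H. Hironaka, J. Math. Kyoto Univ. 10 (1970), THEOREM IV p. 156, (13.1)–(14.3) pp. 168–170;
B. Dietel, Dissertation Regensburg (2015), §9.2, (9.2.3)–(9.2.7) pp. 110–114; J. Giraud (1975) §1.5 (3).
-/

noncomputable section

-- single-conjunct summit: the doubled namespace component `ResolutionOfSingularities` is mandated
set_option linter.dupNamespace false

open IsLocalRing MvPolynomial
open Literature.AlgebraicGeometry.Resolution Literature.AlgebraicGeometry.Resolution.HironakaScheme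

namespace Summit.ResolutionOfSingularities.ResolutionOfSingularities.Theorems

namespace CampaignW42

universe u v

/-! ## The residue field of a prime of a polynomial ring over a perfect field is formally smooth -/

section Residue

variable {K : Type u} [Field K] {σ : Type v}

/-- The residue field `κ(𝔭) = S_𝔭/𝔭S_𝔭` of a prime of `S = K[X_σ]` (`σ` finite) is essentially of finite type over `K`.
[folklore] -/
theorem essFiniteType_residueField_localization [Finite σ] (𝔭 : Ideal (MvPolynomial σ K)) [𝔭.IsPrime] :
    Algebra.EssFiniteType K (ResidueField (Localization.AtPrime 𝔭)) :=
  Algebra.EssFiniteType.of_surjective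
    (IsScalarTower.toAlgHom K (Localization.AtPrime 𝔭) (ResidueField (Localization.AtPrime 𝔭)))
    Ideal.Quotient.mk_surjective

/-- **Over a PERFECT field every such residue field is formally smooth** (Mathlib: an essentially-of-finite-type field
extension of a perfect field is separably generated, hence formally smooth). [folklore] -/
theorem formallySmooth_residueField_of_perfectField [PerfectField K] [Finite σ] (𝔭 : Ideal (MvPolynomial σ K))
    [𝔭.IsPrime] : Algebra.FormallySmooth K (ResidueField (Localization.AtPrime 𝔭)) :=
  haveI := essFiniteType_residueField_localization 𝔭
  Algebra.FormallySmooth.of_perfectField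

end Residue

/-! ## The lifting lemma: `G(X^q) ∈ 𝔭 ⇒ G(X^q) ∈ 𝔭^{(q)}` -/

section Lift

variable {K : Type u} [Field K] {σ : Type v}

/-- **LIFTING LEMMA (local form).** `K` a field of exponential characteristic `p`, `Λ` a local `K`-algebra whose
residue field is formally smooth over `K`, `ψ : K[X_σ] → Λ` a `K`-algebra map, `q = p^e`: if `θ = G(X^q)` (`expand q G`)
is mapped into `𝔪_Λ`, it is mapped into `𝔪_Λ^q`. PROOF: in `Q = Λ/𝔪^q` the residue map has nilpotent kernel, so formal
smoothness gives a `K`-algebra section `s` of `Q ↠ κ`; `ψ(X_i) ≡ s(X̄_i)` modulo the kernel, whose `q`-th powers vanish,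
so by Frobenius `ψ(X_i)^q = s(X̄_i)^q` in `Q` and `ψ(θ) = G(ψ(X)^q) = s(G(X̄^q)) = s(θ̄) = s(0) = 0`.
[cite: Dietel2015, Prop. (9.2.6) p. 112–113] -/
theorem apply_expand_mem_pow_maximalIdeal_of_formallySmooth {Λ : Type*} [CommRing Λ] [IsLocalRing Λ] [Algebra K Λ]
    [Algebra.FormallySmooth K (ResidueField Λ)] (p : ℕ) [ExpChar K p] (e : ℕ)
    (ψ : MvPolynomial σ K →ₐ[K] Λ) (G : MvPolynomial σ K) (hG : ψ (expand (p ^ e) G) ∈ maximalIdeal Λ) :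
    ψ (expand (p ^ e) G) ∈ maximalIdeal Λ ^ p ^ e := by
  classical
  -- the truncation `Q = Λ / 𝔪^q` (`q = p^e`) and its residue map `g : Q → κ`
  have hq0 : p ^ e ≠ 0 := pow_ne_zero _ (expChar_pos K p).ne'
  have hle : maximalIdeal Λ ^ p ^ e ≤ maximalIdeal Λ := Ideal.pow_le_self hq0
  let g : (Λ ⧸ maximalIdeal Λ ^ p ^ e) →ₐ[K] ResidueField Λ :=
    Ideal.Quotient.liftₐ (maximalIdeal Λ ^ p ^ e) (IsScalarTower.toAlgHom K Λ (ResidueField Λ)) fun a ha =>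
      (residue_eq_zero_iff (R := Λ) a).mpr (hle ha)
  have hg_mk : ∀ a : Λ, g (Ideal.Quotient.mk _ a) = residue Λ a := fun a => rfl
  have hg_surj : Function.Surjective g := by
    intro y
    obtain ⟨a, rfl⟩ := Ideal.Quotient.mk_surjective (I := maximalIdeal Λ) y
    exact ⟨Ideal.Quotient.mk _ a, hg_mk a⟩
  have hker : RingHom.ker (g : (Λ ⧸ maximalIdeal Λ ^ p ^ e) →+* ResidueField Λ) =
      (maximalIdeal Λ).map (Ideal.Quotient.mk (maximalIdeal Λ ^ p ^ e)) := by
    ext x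
    obtain ⟨a, rfl⟩ := Ideal.Quotient.mk_surjective x
    rw [RingHom.mem_ker, AlgHom.coe_toRingHom, hg_mk, residue_eq_zero_iff, Ideal.mem_quotient_iff_mem hle]
  have hkerq : RingHom.ker (g : (Λ ⧸ maximalIdeal Λ ^ p ^ e) →+* ResidueField Λ) ^ p ^ e = ⊥ := by
    rw [hker, ← Ideal.map_pow, Ideal.map_quotient_self]
  have hnil : IsNilpotent (RingHom.ker (g : (Λ ⧸ maximalIdeal Λ ^ p ^ e) →+* ResidueField Λ)) := ⟨p ^ e, hkerq⟩
  -- a `K`-algebra section of `g`, by formal smoothness of `κ` over `K`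
  let s : ResidueField Λ →ₐ[K] (Λ ⧸ maximalIdeal Λ ^ p ^ e) :=
    Algebra.FormallySmooth.liftOfSurjective (AlgHom.id K _) g hg_surj hnil
  have hs : ∀ y, g (s y) = y := fun y =>
    Algebra.FormallySmooth.liftOfSurjective_apply (AlgHom.id K _) g hg_surj hnil y
  -- the variables in `Q` and in `κ`
  let y : σ → Λ ⧸ maximalIdeal Λ ^ p ^ e := fun i => Ideal.Quotient.mk _ (ψ (X i))
  let ybar : σ → ResidueField Λ := fun i => residue Λ (ψ (X i))
  have hgy : ∀ i, g (y i) = ybar i := fun i => hg_mk _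
  -- `(ψ X_i - s(X̄_i))^q = 0` in `Q`
  have hdiff : ∀ i, (y i - s (ybar i)) ^ p ^ e = 0 := by
    intro i
    have hmem : y i - s (ybar i) ∈ RingHom.ker (g : (Λ ⧸ maximalIdeal Λ ^ p ^ e) →+* ResidueField Λ) := by
      rw [RingHom.mem_ker, AlgHom.coe_toRingHom, map_sub, hgy, hs, sub_self]
    have h2 := Ideal.pow_mem_pow hmem (p ^ e)
    rwa [hkerq, Ideal.mem_bot] at h2
  -- Frobenius: `ψ(X_i)^q = s(X̄_i)^q` in `Q`
  haveI : Nontrivial (Λ ⧸ maximalIdeal Λ ^ p ^ e) :=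
    Ideal.Quotient.nontrivial_iff.mpr fun htop => (maximalIdeal.isMaximal Λ).ne_top (top_le_iff.mp (htop ▸ hle))
  haveI : ExpChar (Λ ⧸ maximalIdeal Λ ^ p ^ e) p :=
    expChar_of_injective_algebraMap (algebraMap K (Λ ⧸ maximalIdeal Λ ^ p ^ e)).injective p
  have hyq : ∀ i, y i ^ p ^ e = s (ybar i) ^ p ^ e := by
    intro i
    have h := add_pow_expChar_pow (s (ybar i)) (y i - s (ybar i)) (p := p) (n := e)
    rw [add_sub_cancel, hdiff, add_zero] at h
    exact h
  -- the two maps `S → Q`, `S → κ` as evaluations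
  have htoQ : (Ideal.Quotient.mkₐ K (maximalIdeal Λ ^ p ^ e)).comp ψ = aeval y :=
    MvPolynomial.algHom_ext fun i => by simp [y]
  have htoκ : (IsScalarTower.toAlgHom K Λ (ResidueField Λ)).comp ψ = aeval ybar :=
    MvPolynomial.algHom_ext fun i => by simp [ybar]
  -- evaluate `θ = G(X^q)` in `Q`
  have h1 : Ideal.Quotient.mk (maximalIdeal Λ ^ p ^ e) (ψ (expand (p ^ e) G)) = aeval (fun i => y i ^ p ^ e) G := by
    change ((Ideal.Quotient.mkₐ K (maximalIdeal Λ ^ p ^ e)).comp ψ) (expand (p ^ e) G) = _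
    rw [htoQ, ← AlgHom.comp_apply, aeval_comp_expand]
    rfl
  have h2 : (fun i => y i ^ p ^ e) = fun i => s (ybar i ^ p ^ e) := by
    funext i
    rw [hyq, map_pow]
  have h3 : aeval (fun i => s (ybar i ^ p ^ e)) G = s (aeval (fun i => ybar i ^ p ^ e) G) := by
    rw [← MvPolynomial.comp_aeval, AlgHom.comp_apply]
  have h4 : aeval (fun i => ybar i ^ p ^ e) G = residue Λ (ψ (expand (p ^ e) G)) := by
    change _ = ((IsScalarTower.toAlgHom K Λ (ResidueField Λ)).comp ψ) (expand (p ^ e) G)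
    rw [htoκ, ← AlgHom.comp_apply, aeval_comp_expand]
    rfl
  have h5 : residue Λ (ψ (expand (p ^ e) G)) = 0 := (residue_eq_zero_iff _).mpr hG
  rw [← Ideal.Quotient.eq_zero_iff_mem, h1, h2, h3, h4, h5, map_zero]

/-- **LIFTING LEMMA (symbolic-power form).** `K` a field of exponential characteristic `p`, `𝔭 ⊂ K[X_σ]` a prime whose
residue field `κ(𝔭)` is formally smooth over `K` (e.g. every `𝔭` when `K` is perfect), `q = p^e`: if `θ = G(X^q)`
(`expand q G`) lies in `𝔭`, then `θ ∈ 𝔭^{(q)}`, i.e. `s · θ ∈ 𝔭^q` for some `s ∉ 𝔭` (tree `HironakaScheme.symbPow`).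
Replaces Dietel's `p`-basis descent (9.2.6) at separable points by formal smoothness; at inseparable points the statement
is false (e.g. `θ = X_1^p − tX_0^p`, `𝔭 = (θ)`, `t ∉ K^p`). [cite: Dietel2015, Prop. (9.2.6) p. 112–113] -/
theorem expand_mem_symbPow_of_formallySmooth (𝔭 : Ideal (MvPolynomial σ K)) [𝔭.IsPrime]
    [Algebra.FormallySmooth K (ResidueField (Localization.AtPrime 𝔭))]
    (p : ℕ) [ExpChar K p] (e : ℕ) (G : MvPolynomial σ K) (hG : expand (p ^ e) G ∈ 𝔭) :
    expand (p ^ e) G ∈ symbPow K 𝔭 (p ^ e) := by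
  have hmax : (IsScalarTower.toAlgHom K (MvPolynomial σ K) (Localization.AtPrime 𝔭)) (expand (p ^ e) G) ∈
      maximalIdeal (Localization.AtPrime 𝔭) :=
    (IsLocalization.AtPrime.to_map_mem_maximal_iff (Localization.AtPrime 𝔭) 𝔭 _).mpr hG
  have hmemq := apply_expand_mem_pow_maximalIdeal_of_formallySmooth p e
    (IsScalarTower.toAlgHom K (MvPolynomial σ K) (Localization.AtPrime 𝔭)) G hmax
  rw [IsScalarTower.coe_toAlgHom', ← Localization.AtPrime.map_eq_maximalIdeal, ← Ideal.map_pow,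
    IsLocalization.algebraMap_mem_map_algebraMap_iff 𝔭.primeCompl] at hmemq
  obtain ⟨m, hm, hmθ⟩ := hmemq
  exact ⟨m, hm, hmθ⟩

/-- **An additive form `Σ_k c_k X_k^{p^e}` lying in a prime `𝔭` with formally smooth residue field is a homogeneous
generator of Hironaka's `U(𝔭)`** (multiplicity `p^e` = degree at `𝔭`). [cite: Dietel2015, Lemma (9.1.4) p. 108 and Prop. (9.2.6)] -/
theorem sum_C_mul_X_pow_mem_multGens {n : ℕ} (𝔭 : Ideal (MvPolynomial (Fin n) K)) [𝔭.IsPrime]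
    [Algebra.FormallySmooth K (ResidueField (Localization.AtPrime 𝔭))]
    (p : ℕ) [ExpChar K p] (c : Fin n → K) (e : ℕ)
    (h : (∑ k, C (c k) * X k ^ p ^ e : MvPolynomial (Fin n) K) ∈ 𝔭) :
    (∑ k, C (c k) * X k ^ p ^ e : MvPolynomial (Fin n) K) ∈ multGens K 𝔭 := by
  have hexp : (∑ k, C (c k) * X k ^ p ^ e : MvPolynomial (Fin n) K) =
      expand (p ^ e) (∑ k, C (c k) * X k : MvPolynomial (Fin n) K) := by
    simp [map_sum, expand_X]
  refine ⟨p ^ e, ?_, ?_⟩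
  · refine IsHomogeneous.sum _ _ _ fun k _ => ?_
    exact (isHomogeneous_X_pow k (p ^ e)).C_mul (c k)
  · rw [hexp] at h ⊢
    exact expand_mem_symbPow_of_formallySmooth 𝔭 p e _ h

end Lift

/-! ## Giraud's ridge algebra inside Hironaka's `U(𝔭)`; the conclusion of Theorem IV for a cone -/

section Cone

variable {K : Type u} [Field K] {n : ℕ}

/-- **`U_F ⊆ U(𝔭)`**: if the additive forms of the ridge ideal `𝔉(I)` lie in a prime `𝔭` with formally smooth residue
field (i.e. the point `𝔭` lies on the ridge `F = V(𝔉)`), then Giraud's algebra of invariants `K[ridgeForm p I]` lies in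
Hironaka's algebra `U(𝔭)` — Hironaka's «`B_{g,x'} ⊆ F`» read on invariant algebras. [cite: Dietel2015, Thm. (9.2.3) and Prop. (9.2.4) (iii) p. 110–111] -/
theorem ridgeAlgebra_le_multAlgebra (I : Ideal (MvPolynomial (Fin n) K)) (𝔭 : Ideal (MvPolynomial (Fin n) K))
    [𝔭.IsPrime] [Algebra.FormallySmooth K (ResidueField (Localization.AtPrime 𝔭))] (p : ℕ) [ExpChar K p]
    (h𝔭 : ∀ j : RidgeFormIndex p I, ridgeForm p I j ∈ 𝔭) : ridgeAlgebra p I ≤ multAlgebra K 𝔭 := by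
  refine Algebra.adjoin_le ?_
  rintro _ ⟨j, rfl⟩
  exact Algebra.subset_adjoin (sum_C_mul_X_pow_mem_multGens 𝔭 p j.1.1 j.1.2 (h𝔭 j))

/-- **THE CONCLUSION OF [H4] THEOREM IV for a cone, at a ridge point with formally smooth residue field**: for `I`
homogeneous, if the additive forms of `𝔉(I)` lie in `𝔭`, then `I` is generated by its elements in `U(𝔭)`:
`I ≤ span(I ∩ U(𝔭))` (Giraud's (3) `I = (I ∩ U_F) S` and `U_F ⊆ U(𝔭)`). [cite: Dietel2015, Thm. (9.2.3) p. 110]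
[cite: Giraud1975, §1.5 (3) p.204] -/
theorem le_span_inter_multAlgebra_of_forall_ridgeForm_mem (I : Ideal (MvPolynomial (Fin n) K))
    (hI : ∀ f ∈ I, ∀ d : ℕ, homogeneousComponent d f ∈ I) (𝔭 : Ideal (MvPolynomial (Fin n) K)) [𝔭.IsPrime]
    [Algebra.FormallySmooth K (ResidueField (Localization.AtPrime 𝔭))] (p : ℕ) [ExpChar K p]
    (h𝔭 : ∀ j : RidgeFormIndex p I, ridgeForm p I j ∈ 𝔭) :
    I ≤ Ideal.span ((I : Set (MvPolynomial (Fin n) K)) ∩ (multAlgebra K 𝔭 : Set (MvPolynomial (Fin n) K))) := by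
  calc I = Ideal.span ((I : Set (MvPolynomial (Fin n) K)) ∩ (ridgeAlgebra p I : Set (MvPolynomial (Fin n) K))) :=
        eq_span_inter_ridgeAlgebra hI
    _ ≤ Ideal.span ((I : Set (MvPolynomial (Fin n) K)) ∩ (multAlgebra K 𝔭 : Set (MvPolynomial (Fin n) K))) :=
        Ideal.span_mono (Set.inter_subset_inter_right _ (ridgeAlgebra_le_multAlgebra I 𝔭 p h𝔭))

/-- The same with the ridge hypothesis in functorial form: **every `k'`-point `v` of the ridge `F(I)` whose homogeneous
prime `𝔭_v` (the forms vanishing at `v`) … ** — concretely: if every element of the ridge ideal `𝔉(I)` is killed by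
`aeval v` for some `K`-algebra `k'` and point `v`, and `𝔭` contains every FORM killed by `aeval v`, then `I ≤ span(I ∩ U(𝔭))`.
[cite: Dietel2015, Thm. (9.2.3) p. 110] -/
theorem le_span_inter_multAlgebra_of_forall_aeval_eq_zero (I : Ideal (MvPolynomial (Fin n) K))
    (hI : ∀ f ∈ I, ∀ d : ℕ, homogeneousComponent d f ∈ I) (𝔭 : Ideal (MvPolynomial (Fin n) K)) [𝔭.IsPrime]
    [Algebra.FormallySmooth K (ResidueField (Localization.AtPrime 𝔭))]
    {k' : Type u} [CommRing k'] [Algebra K k'] (v : Fin n → k')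
    (hv : ∀ g ∈ ridgeIdeal I, aeval v g = 0)
    (h𝔭 : ∀ (f : MvPolynomial (Fin n) K) (d : ℕ), f.IsHomogeneous d → aeval v f = 0 → f ∈ 𝔭) :
    I ≤ Ideal.span ((I : Set (MvPolynomial (Fin n) K)) ∩ (multAlgebra K 𝔭 : Set (MvPolynomial (Fin n) K))) := by
  obtain ⟨p, hp⟩ := ExpChar.exists K
  refine le_span_inter_multAlgebra_of_forall_ridgeForm_mem I hI 𝔭 p fun j => ?_
  refine h𝔭 _ (p ^ j.1.2) ?_ (hv _ (ridgeForm_mem_ridgeIdeal j))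
  refine IsHomogeneous.sum _ _ _ fun k _ => ?_
  exact (isHomogeneous_X_pow k (p ^ j.1.2)).C_mul (j.1.1 k)

end Cone

end CampaignW42

end Summit.ResolutionOfSingularities.ResolutionOfSingularities.Theorems

end
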